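import Literature.AlgebraicGeometry.GroupSchemes.StrictBirationalGroupLaw
import Literature.NumberTheory.EllipticCurves.NeronModelGroupStructure
import Literature.NumberTheory.EllipticCurves.NeronModelCodimOne
import Mathlib.AlgebraicGeometry.Geometrically.Irreducible
import HarnessLib

/-!
# A birational group law from open-immersion shears over a discrete valuation ring

Topic `Literature/AlgebraicGeometry/GroupSchemes`, namespace `Literature.AlgebraicGeometry.GroupSchemes`
(currency of `StrictBirationalGroupLaw`: `IsFibrewiseDense`, `LawData.shearLeft/shearRight`,
`LawData.Computes`, `BirationalGroupLaw`).

Bosch–Lütkebohmert–Raynaud §5.1 Def. 1 / Edixhoven–Romagny Def. 3.4 (1),(3) ask of an `S`-birational group law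
that its domain and the images of the two shears be `S`-DENSE and that the law be associative where defined.
Over `S = Spec R`, `R` a discrete valuation ring, `S` has two points, so for a smooth `𝒳 → S` with geometrically
irreducible fibres an open of `𝒳 ×_S 𝒳` is dense in every fibre as soon as it contains the generic fibre and meets
the special fibre (which is irreducible). Hence the output of the ω-argument (E–R Thm. 6.3: a partial
multiplication `m` on an open `U ⊇` generic fibre meeting the special fibre, with shears `Φ = (pr₁, m)`,
`Ψ = (m, pr₂)` OPEN IMMERSIONS whose images contain the generic fibre) together with associativity on
`T`-points IS a birational group law:

* `eq_closedPoint_or_mem_range_specGenericPoint` — a point of `Spec R` is the closed point or the generic one;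
* `isFibrewiseDense_of_isOpen_of_generic_of_special` — **an open containing the generic fibre and meeting the
  special fibre is fibrewise dense**, for `𝒴 → Spec R` geometrically irreducible and universally open;
* (private) `smooth_tensorObj_hom`, `geometricallyIrreducible_tensorObj_hom` — `𝒳 ×_S 𝒳 → S` is smooth with
  geometrically irreducible fibres;
* **`exists_birationalGroupLaw_of_shears`** — the packaging itself (the two extra clauses «`dom ⊇` generic
  fibre» and «`m` is the group law of the generic fibre `E`» are carried through verbatim).

Cell `hodgecm-mathlib`, road W of `r₀`: GAP-A1 of the Koizumi closer (A-p14's probe `W0Packaging`), the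
associativity input being GAP-A2 (`LawData.assoc_of_genericFibre`). Theorems only; no definitions, no named facts.

## References
* B. Edixhoven, M. Romagny, *Group schemes out of birational group laws, Néron models*, Panoramas et
  Synthèses 47 (2015), Def. 3.1, Def. 3.4, Thm. 6.3. [EdixhovenRomagny]
* S. Bosch, W. Lütkebohmert, M. Raynaud, *Néron Models*, Springer 1990, §2.5 (S-dense opens), §5.1 Def. 1.
  [BLRNeronModels1990] (Not held; numbers only.)
-/

noncomputable section

universe u

namespace Literature.AlgebraicGeometry.GroupSchemes

open CategoryTheory Limits _root_.AlgebraicGeometry MonoidalCategory CartesianMonoidalCategory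
open TopologicalSpace Literature.NumberTheory.EllipticCurves IsLocalRing
open scoped MonObj

variable (R : Type u) [CommRing R] [IsDomain R] [IsDiscreteValuationRing R]
  (K : Type u) [Field K] [Algebra R K] [IsFractionRing R K]

/-! ### The two points of `Spec R` -/

/-- A point of the spectrum of a discrete valuation ring is either the closed point or the generic point
(the image of `Spec K → Spec R`) — the two-point base of E–R §6 / BLR §2.5. [cite: BLRNeronModels1990, §2.5] -/
theorem eq_closedPoint_or_mem_range_specGenericPoint (s : Spec (.of R)) :
    s = closedPoint R ∨ s ∈ Set.range (specGenericPoint R K).base := by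
  by_cases hs : s.asIdeal = ⊥
  · right
    have hgen : s = genericPoint (Spec (.of R)) := by
      rw [genericPoint_eq_bot_of_affine]
      exact PrimeSpectrum.ext hs
    rw [hgen]
    exact genericPoint_mem_range_specGenericPoint
  · left
    apply PrimeSpectrum.ext
    exact IsLocalRing.eq_maximalIdeal (IsPrime.to_maximal_ideal hs)

/-! ### Fibrewise density over a discrete valuation ring -/

variable {R K}

/-- **Over a discrete valuation ring, an open containing the generic fibre and meeting the special fibre is
dense in every fibre**, for `𝒴 → Spec R` universally open (e.g. flat of finite presentation) with geometrically
irreducible fibres: the generic fibre lies in the open outright, and the special fibre is irreducible, so any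
open meeting it is dense in it (E–R Def. 3.1 / BLR §2.5 «S-dense»). [cite: EdixhovenRomagny, Def. 3.1 and Prop. 3.2]
[cite: BLRNeronModels1990, §2.5] -/
theorem isFibrewiseDense_of_isOpen_of_generic_of_special (𝒴 : Over (Spec (.of R)))
    [GeometricallyIrreducible 𝒴.hom] [UniversallyOpen 𝒴.hom] {W : Set 𝒴.left} (hW : IsOpen W)
    (hgen : 𝒴.hom.base ⁻¹' Set.range (specGenericPoint R K).base ⊆ W)
    (hsp : ∃ y ∈ W, 𝒴.hom.base y = closedPoint R) :
    IsFibrewiseDense 𝒴.hom W := by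
  intro s
  rcases eq_closedPoint_or_mem_range_specGenericPoint R K s with rfl | hs
  · have hirr : IsIrreducible (𝒴.hom.base ⁻¹' {closedPoint R}) :=
      𝒴.hom.isIrreducible_preimage 𝒴.hom.isOpenMap isIrreducible_singleton
    obtain ⟨y, hyW, hy⟩ := hsp
    have h := subset_closure_inter_of_isPreirreducible_of_isOpen hirr.isPreirreducible hW ⟨y, hy, hyW⟩
    rwa [Set.inter_comm] at h
  · intro y hy
    apply subset_closure
    refine ⟨hgen ?_, hy⟩
    have hy' : 𝒴.hom.base y = s := hy
    change 𝒴.hom.base y ∈ Set.range (specGenericPoint R K).base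
    rw [hy']
    exact hs

/-! ### `𝒳 ×_S 𝒳` -/

variable (𝒳 : Over (Spec (.of R))) [Smooth 𝒳.hom] [GeometricallyIrreducible 𝒳.hom]

omit [IsDomain R] [IsDiscreteValuationRing R] [GeometricallyIrreducible 𝒳.hom] in
/-- `𝒳 ×_S 𝒳 → S` is smooth (★ `smooth_tensorObj_hom_of_smooth`; plumbing). [folklore] -/
private theorem smooth_tensorObj_hom : Smooth (𝒳 ⊗ 𝒳).hom :=
  smooth_tensorObj_hom_of_smooth ‹_› ‹_›

omit [IsDomain R] [IsDiscreteValuationRing R] in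
/-- `𝒳 ×_S 𝒳 → S` has geometrically irreducible fibres: it is `pr₁ ≫ (𝒳 → S)`, a composite of universally
open geometrically irreducible morphisms (Mathlib `GeometricallyIrreducible.comp`).
[cite: EdixhovenRomagny, Assumptions 3.3] -/
theorem geometricallyIrreducible_tensorObj_hom : GeometricallyIrreducible (𝒳 ⊗ 𝒳).hom := by
  rw [Over.tensorObj_hom]
  exact @GeometricallyIrreducible.comp _ _ _ (pullback.fst 𝒳.hom 𝒳.hom) 𝒳.hom
    (MorphismProperty.pullback_fst _ _ inferInstance) inferInstance
    (MorphismProperty.pullback_fst _ _ inferInstance) inferInstance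

/-! ### The packaging -/

/-- **A birational group law from open-immersion shears** (BLR 5.1/1, E–R Def. 3.4 (1),(3) over a
discrete valuation ring). Let `𝒳 → Spec R` be smooth, proper, with geometrically irreducible fibres, `E` a
`K`-group scheme with `𝒳_K ≅ E`, and let `m : U → 𝒳` be a partial multiplication on an open
`U ⊆ 𝒳 ×_S 𝒳` containing the generic fibre and meeting the special fibre, equal to the group law of `E` on
the generic fibre, whose shears `Φ = (pr₁, m)`, `Ψ = (m, pr₂)` are open immersions with images containing
the generic fibre (the conclusion of the ω-argument, E–R Thm. 6.3), and which is associative on `T`-points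
where defined. Then `(U, m)` is a birational group law on `𝒳` whose domain contains the generic fibre and
whose multiplication is the group law of `E` generically. [cite: EdixhovenRomagny, Def. 3.4 and Thm. 6.3]
[cite: BLRNeronModels1990, §5.1 Def. 1] -/
theorem exists_birationalGroupLaw_of_shears [IsProper 𝒳.hom] (E : Over (Spec (.of K))) [GrpObj E]
    (e : (genericFibre R K).obj 𝒳 ≅ E)
    (U : (𝒳 ⊗ 𝒳).left.Opens) (m : (U : Scheme.{u}) ⟶ 𝒳.left)
    (hm : m ≫ 𝒳.hom = U.ι ≫ (𝒳 ⊗ 𝒳).hom)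
    (hU : (𝒳 ⊗ 𝒳).hom.base ⁻¹' Set.range (specGenericPoint R K).base ⊆ (U : Set (𝒳 ⊗ 𝒳).left))
    (hu : ∃ u : (𝒳 ⊗ 𝒳).left, u ∈ U ∧ (𝒳 ⊗ 𝒳).hom.base u = IsLocalRing.closedPoint R)
    (hgen : (genericFibre R K).map (Over.homMk m hm : Over.mk (U.ι ≫ (𝒳 ⊗ 𝒳).hom) ⟶ 𝒳) ≫ e.hom =
        (genericFibre R K).map (Over.homMk U.ι rfl : Over.mk (U.ι ≫ (𝒳 ⊗ 𝒳).hom) ⟶ 𝒳 ⊗ 𝒳) ≫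
          Functor.OplaxMonoidal.δ (genericFibre R K) 𝒳 𝒳 ≫ (e.hom ⊗ₘ e.hom) ≫ μ[E])
    (hΦ : IsOpenImmersion (LawData.shearLeft 𝒳 U m hm).left)
    (hΦgen : (𝒳 ⊗ 𝒳).hom.base ⁻¹' Set.range (specGenericPoint R K).base ⊆
      Set.range (LawData.shearLeft 𝒳 U m hm).left.base)
    (hΨ : IsOpenImmersion (LawData.shearRight 𝒳 U m hm).left)
    (hΨgen : (𝒳 ⊗ 𝒳).hom.base ⁻¹' Set.range (specGenericPoint R K).base ⊆
      Set.range (LawData.shearRight 𝒳 U m hm).left.base)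
    (hassoc : ∀ {T : Scheme.{u}} {a b c ab bc abc abc' : T ⟶ 𝒳.left} {q₁ q₂ q₃ q₄ : T ⟶ (U : Scheme.{u})},
      LawData.Computes 𝒳 U m q₁ a b ab → LawData.Computes 𝒳 U m q₂ b c bc →
      LawData.Computes 𝒳 U m q₃ ab c abc → LawData.Computes 𝒳 U m q₄ a bc abc' → abc = abc') :
    ∃ L : BirationalGroupLaw 𝒳,
      (𝒳 ⊗ 𝒳).hom.base ⁻¹' Set.range (specGenericPoint R K).base ⊆ (L.dom : Set (𝒳 ⊗ 𝒳).left) ∧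
      (genericFibre R K).map L.mulOver ≫ e.hom =
        (genericFibre R K).map (LawData.inclOver 𝒳 L.dom) ≫
          Functor.OplaxMonoidal.δ (genericFibre R K) 𝒳 𝒳 ≫ (e.hom ⊗ₘ e.hom) ≫ μ[E] := by
  -- `𝒴 := 𝒳 ×_S 𝒳` is smooth with geometrically irreducible fibres
  haveI : Smooth (𝒳 ⊗ 𝒳).hom := smooth_tensorObj_hom 𝒳
  haveI : GeometricallyIrreducible (𝒳 ⊗ 𝒳).hom := geometricallyIrreducible_tensorObj_hom 𝒳
  obtain ⟨u, huU, hus⟩ := hu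
  -- the shears are morphisms over `S`, so `Φ u`, `Ψ u` lie over the closed point
  have hΦw : (LawData.shearLeft 𝒳 U m hm).left ≫ (𝒳 ⊗ 𝒳).hom = U.ι ≫ (𝒳 ⊗ 𝒳).hom :=
    Over.w (LawData.shearLeft 𝒳 U m hm)
  have hΨw : (LawData.shearRight 𝒳 U m hm).left ≫ (𝒳 ⊗ 𝒳).hom = U.ι ≫ (𝒳 ⊗ 𝒳).hom :=
    Over.w (LawData.shearRight 𝒳 U m hm)
  have hΦu : (𝒳 ⊗ 𝒳).hom.base ((LawData.shearLeft 𝒳 U m hm).left.base ⟨u, huU⟩) = closedPoint R := by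
    change ((LawData.shearLeft 𝒳 U m hm).left ≫ (𝒳 ⊗ 𝒳).hom).base ⟨u, huU⟩ = _
    rw [hΦw]
    exact hus
  have hΨu : (𝒳 ⊗ 𝒳).hom.base ((LawData.shearRight 𝒳 U m hm).left.base ⟨u, huU⟩) = closedPoint R := by
    change ((LawData.shearRight 𝒳 U m hm).left ≫ (𝒳 ⊗ 𝒳).hom).base ⟨u, huU⟩ = _
    rw [hΨw]
    exact hus
  -- the three fibrewise densities
  have hdense_dom : IsFibrewiseDense (𝒳 ⊗ 𝒳).hom (U : Set (𝒳 ⊗ 𝒳).left) :=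
    isFibrewiseDense_of_isOpen_of_generic_of_special (K := K) (𝒳 ⊗ 𝒳) U.2 hU ⟨u, huU, hus⟩
  have hdense_Φ : IsFibrewiseDense (𝒳 ⊗ 𝒳).hom (Set.range (LawData.shearLeft 𝒳 U m hm).left.base) :=
    isFibrewiseDense_of_isOpen_of_generic_of_special (K := K) (𝒳 ⊗ 𝒳)
      (LawData.shearLeft 𝒳 U m hm).left.isOpenEmbedding.isOpen_range hΦgen ⟨_, ⟨⟨u, huU⟩, rfl⟩, hΦu⟩
  have hdense_Ψ : IsFibrewiseDense (𝒳 ⊗ 𝒳).hom (Set.range (LawData.shearRight 𝒳 U m hm).left.base) :=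
    isFibrewiseDense_of_isOpen_of_generic_of_special (K := K) (𝒳 ⊗ 𝒳)
      (LawData.shearRight 𝒳 U m hm).left.isOpenEmbedding.isOpen_range hΨgen ⟨_, ⟨⟨u, huU⟩, rfl⟩, hΨu⟩
  refine ⟨⟨U, m, hm, hdense_dom, hΦ, hdense_Φ, hΨ, hdense_Ψ, hassoc⟩, hU, ?_⟩
  exact hgen

end Literature.AlgebraicGeometry.GroupSchemes

end
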